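import Literature.AlgebraicGeometry.AbelianSchemes.SerreTensorIdealTranslationKernel
import Literature.AlgebraicGeometry.AbelianSchemes.AbelianSchemeHomDescentEquivariant
import HarnessLib

/-!
# Recognition of the Serre tensor: an `𝒪`-equivariant isogeny out of `A` killing exactly `A[𝔭]` IS `A ⟶ A ⊗_𝒪 𝔭⁻¹`

Topic `AlgebraicGeometry/AbelianSchemes`, namespace `Literature.AlgebraicGeometry.AbelianSchemes.AbelianSchemeOver` (THEOREMS ONLY; no
definition, no named fact, no `sorry`, no `instance`, no notation; ANY base scheme `S`, any commutative `𝒪`).  Cell `hodgecm-mathlib`, F0/P6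
«MOD», organ **ST-2 (recognition form)** of desk F0P6a-plan (g0) (ED3-CENSUS-P6a v1 §3 «an `𝒪_F`-isogeny `ψ : A′ → B` with `ker ψ = A′[𝔞]`
identifies `B ≅ A′ ⊗ 𝔞⁻¹` compatibly with `ι`»), composing ★ (A) `SerreTensorIdealTranslationKernel` (p845164) with ★ ST-2b (core)
`AbelianSchemeHomDescentEquivariant` (p845176) and ★ (o-c3k) `AbelianSchemeHomDescentFlatSurjective`; `--supports stmt-HodgeConjecture-24832`,
count-neutral.  HC_CM is proved only modulo the 2 remaining named inputs (hLiu418, h413) until rung 0 closes; this file discharges none of them.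

## Mathematics

Fix `act : 𝒪 → End(A)`, a presented module `𝔟 = E′·𝒪ᵐ`, an element `P ∈ 𝔟` (`E′P = P`) whose coordinates generate the ideal `𝔭`, and a
quasi-inverse row `Q` up to `N ≠ 0` (`QE′ = Q`, `QP = N`, `PQ = N·E′`) — the data of «`𝒪 ↪ 𝔭⁻¹` with `N ∈ 𝔭`».  Then `ψ_P : A → A ⊗_𝒪 𝔟` (★
`serreTranslate`) is an `𝒪`-equivariant finite flat surjective homomorphism with `Ker ψ_P = A[𝔭]` on points (★ (A)).  CONSEQUENCES:
(§1) `A[𝔭]` is `ι`-stable and the Serre `𝒪`-action on `A ⊗_𝒪 𝔟` IS the action descended from `A` through `ψ_P` (★ `RingAction.descend`,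
uniqueness); (§2) **RECOGNITION** ([MumfordAV1970] §7 Thm. 4 + degrees): for ANY abelian scheme `B` with `𝒪`-action `ι_B` and ANY
`𝒪`-equivariant finite flat homomorphism `φ : A → B` killing `A[𝔭]` on points, of the same constant degree as `ψ_P`, there is a UNIQUE
`e : A ⊗_𝒪 𝔟 ≅ B` over `S` with `ψ_P ≫ e = φ`; it is a homomorphism and `𝒪`-EQUIVARIANT (`ι_{A⊗𝔟}(a) ≫ e = e ≫ ι_B(a)`), and then `φ` kills
EXACTLY `A[𝔭]` — «the quotient of `(A, ι)` by `A[𝔭]` is `(A ⊗_𝒪 𝔭⁻¹, ι)`», the identification behind `transl`∕(c3b)∕(c3c)∕HEART-FROB.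

## Contents

* §1 `serreTranslate_stabilises_torsion`, `quasiCompact_serreTranslate_left`, **`serreAction_i_eq_descend_i`**;
* §2 **`exists_iso_serreTranslate_comp_eq_of_forall_comp_eq_one`** (the `𝒪`-equivariant recognition of `A ⊗_𝒪 𝔟` under `A`, with uniqueness),
  `comp_eq_one_iff_forall_mem_of_serreTranslate_comp_eq` (then `Ker φ = A[𝔭]` exactly).

## References
* [MumfordAV1970] D. Mumford, *Abelian Varieties* (1970), §7 Thm. 4 (p. 72).
* [Conrad2004GrossZagier] B. Conrad, *Gross–Zagier revisited*, MSRI Publ. 49 (2004), §7 (Thm. 7.5).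
* [MilneCM2006] J. S. Milne, *Complex Multiplication* (2006), §7 «𝔞-multiplications: first approach», Def. 7.19, Prop. 7.22, Rem. 7.23 (pp. 58–59) (`λ^𝔞 : A → A^𝔞` is the quotient by `A[𝔞]`).
* Tree: ★ `SerreTensorIdealTranslationKernel`, ★ `AbelianSchemeHomDescentEquivariant`, ★ `AbelianSchemeHomDescentFlatSurjective`.
-/

noncomputable section

universe u

open CategoryTheory CategoryTheory.Limits AlgebraicGeometry MonoidalCategory CartesianMonoidalCategory
open scoped MonObj

namespace Literature.AlgebraicGeometry.AbelianSchemes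

namespace AbelianSchemeOver

variable {S : Scheme.{u}} {A : AbelianSchemeOver S} {O : Type*} [CommRing O] (act : A.RingAction O) [IsCommMonObj A.X]
  {m : ℕ} (E' : Matrix (Fin m) (Fin m) O) (hE' : E' * E' = E') (P : Matrix (Fin m) (Fin 1) O) (Q : Matrix (Fin 1) (Fin m) O) {N : ℕ}

/-! ## §1 `A[𝔭]` is `ι`-stable; the Serre action on `A ⊗_𝒪 𝔟` is the descended action -/

/-- **`Ker ψ_P` is `ι`-stable** (`ψ_P` is `𝒪`-equivariant for the Serre action). [cite: Conrad2004GrossZagier, §7 (Thm. 7.5)] -/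
theorem serreTranslate_stabilises_torsion (hP : E' * P = P) (a : O) ⦃T : Over S⦄ (t : T ⟶ A.X)
    (ht : t ≫ serreTranslate act E' hE' P = 1) : (t ≫ act.i a) ≫ serreTranslate act E' hE' P = 1 :=
  RingAction.stabilises_ker_of_comp_eq (serreTranslate act E' hE' P) act (j := (serreAction act E' hE').i)
    (serreAction act E' hE').isMonHom (i_comp_serreTranslate act E' hE' P hP) a t ht

/-- `ψ_P.left` is quasi-compact (it is finite under the quasi-inverse hypotheses). [cite: GortzWedhorn2023, Cor. 27.177 (1)] -/
theorem quasiCompact_serreTranslate_left (hN : N ≠ 0) (hP : E' * P = P) (hQ : Q * E' = Q)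
    (hQP : Q * P = Matrix.scalar (Fin 1) (N : O)) (hPQ : P * Q = Matrix.scalar (Fin m) (N : O) * E') :
    QuasiCompact (serreTranslate act E' hE' P).left := by
  haveI := isFinite_serreTranslate_left act E' hE' P Q hN hP hQ hQP hPQ
  infer_instance

/-- **The Serre `𝒪`-action on `A ⊗_𝒪 𝔟` IS the action descended from `A` through `ψ_P`** (uniqueness of the descended action, ★
`RingAction.descend_i_unique`). [cite: MumfordAV1970, §7 Thm. 4 (p. 72)] [cite: Conrad2004GrossZagier, §7 (Thm. 7.5)] -/
theorem serreAction_i_eq_descend_i (hN : N ≠ 0) (hP : E' * P = P) (hQ : Q * E' = Q)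
    (hQP : Q * P = Matrix.scalar (Fin 1) (N : O)) (hPQ : P * Q = Matrix.scalar (Fin m) (N : O) * E') (a : O) :
    haveI := isMonHom_serreTranslate act E' hE' P
    haveI := flat_serreTranslate_left act E' hE' P Q hN hP hQ hQP hPQ
    haveI := surjective_serreTranslate_left act E' hE' P Q hN hP hQ hQP hPQ
    haveI := quasiCompact_serreTranslate_left act E' hE' P Q hN hP hQ hQP hPQ
    (serreAction act E' hE').i a =
      (RingAction.descend (serreTranslate act E' hE' P) act (serreTranslate_stabilises_torsion act E' hE' P hP)).i a :=
  haveI := isMonHom_serreTranslate act E' hE' P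
  haveI := flat_serreTranslate_left act E' hE' P Q hN hP hQ hQP hPQ
  haveI := surjective_serreTranslate_left act E' hE' P Q hN hP hQ hQP hPQ
  haveI := quasiCompact_serreTranslate_left act E' hE' P Q hN hP hQ hQP hPQ
  RingAction.descend_i_unique (serreTranslate act E' hE' P) act (serreTranslate_stabilises_torsion act E' hE' P hP)
    (serreAction act E' hE') (i_comp_serreTranslate act E' hE' P hP) a

/-! ## §2 Recognition of `A ⊗_𝒪 𝔟` under `A` among `𝒪`-equivariant isogenies killing `A[𝔭]` -/

variable {B : AbelianSchemeOver S} (actB : B.RingAction O) (φ : A.X ⟶ B.X)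

/-- **RECOGNITION OF THE SERRE TENSOR** ([MumfordAV1970] §7 Thm. 4 + degrees; [MilneCM2006] §7): with `ψ_P : A → A ⊗_𝒪 𝔟` as above
(coordinates of `P` generating `𝔭`, quasi-inverse `Q` up to `N ≠ 0`), let `φ : A → B` be an `𝒪`-EQUIVARIANT homomorphism with `φ.left` finite
flat, KILLING `A[𝔭]` on points (`(∀ a ∈ 𝔭, ι(a) t = 1) → t ≫ φ = 1`), of the same constant degree `d` as `ψ_P`.  THEN there is an isomorphism
`e : A ⊗_𝒪 𝔟 ≅ B` over `S` with `ψ_P ≫ e = φ`; it is a homomorphism, `𝒪`-equivariant for the Serre action and `ι_B`, and the unique factorisation.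
[cite: MumfordAV1970, §7 Thm. 4 (p. 72)] [cite: MilneCM2006, §7 (Def. 7.19, Prop. 7.22, Rem. 7.23, pp. 58–59)] [cite: Conrad2004GrossZagier, §7 (Thm. 7.5)] -/
theorem exists_iso_serreTranslate_comp_eq_of_forall_comp_eq_one [IsMonHom φ] [IsFinite φ.left] [Flat φ.left]
    (hN : N ≠ 0) (hP : E' * P = P) (hQ : Q * E' = Q)
    (hQP : Q * P = Matrix.scalar (Fin 1) (N : O)) (hPQ : P * Q = Matrix.scalar (Fin m) (N : O) * E')
    {𝔭 : Ideal O} (h𝔭 : Ideal.span (Set.range fun k => P k 0) = 𝔭)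
    (hφ : ∀ a, act.i a ≫ φ = φ ≫ actB.i a)
    (hker : ∀ ⦃T : Over S⦄ (t : T ⟶ A.X), (∀ a ∈ 𝔭, t ≫ act.i a = 1) → t ≫ φ = 1)
    (d : ℕ) (hdψ : ∀ c : (serreTensor act E' hE').left, (serreTranslate act E' hE' P).left.finrank c = d)
    (hdφ : ∀ b : B.left, φ.left.finrank b = d) :
    ∃ e : (serreTensor act E' hE').X ≅ B.X, serreTranslate act E' hE' P ≫ e.hom = φ ∧ IsMonHom e.hom ∧
      (∀ a, (serreAction act E' hE').i a ≫ e.hom = e.hom ≫ actB.i a) ∧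
        ∀ χ : (serreTensor act E' hE').X ⟶ B.X, serreTranslate act E' hE' P ≫ χ = φ → χ = e.hom := by
  haveI := isMonHom_serreTranslate act E' hE' P
  haveI := isFinite_serreTranslate_left act E' hE' P Q hN hP hQ hQP hPQ
  haveI := flat_serreTranslate_left act E' hE' P Q hN hP hQ hQP hPQ
  haveI := surjective_serreTranslate_left act E' hE' P Q hN hP hQ hQP hPQ
  exact exists_iso_comp_eq_equivariant_of_forall_comp_eq_one (C := serreTensor act E' hE') (serreTranslate act E' hE' P) act actB
    (serreAction act E' hE') φ (i_comp_serreTranslate act E' hE' P hP) hφ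
    (comp_eq_one_of_comp_serreTranslate_eq_one act E' hE' P hP h𝔭 φ hker) d hdψ hdφ

/-- … and then `φ` kills EXACTLY `A[𝔭]`: `t ≫ φ = 1 ↔ ∀ a ∈ 𝔭, ι(a) t = 1` (for any `e` with `ψ_P ≫ e.hom = φ`, `e` a homomorphism).
[cite: MumfordAV1970, §7 Thm. 4 (p. 72)] [cite: MilneCM2006, §7 (Def. 7.19, Prop. 7.22, Rem. 7.23, pp. 58–59)] -/
theorem comp_eq_one_iff_forall_mem_of_serreTranslate_comp_eq (hP : E' * P = P) {𝔭 : Ideal O}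
    (h𝔭 : Ideal.span (Set.range fun k => P k 0) = 𝔭) (e : (serreTensor act E' hE').X ≅ B.X) [IsMonHom e.hom]
    (he : serreTranslate act E' hE' P ≫ e.hom = φ) {T : Over S} (t : T ⟶ A.X) :
    t ≫ φ = 1 ↔ ∀ a ∈ 𝔭, t ≫ act.i a = 1 := by
  rw [← comp_serreTranslate_eq_one_iff_forall_mem act E' hE' P hP h𝔭 t]
  exact (comp_eq_one_iff_of_iso_comp_eq A (serreTranslate act E' hE' P) φ e he t).symm

end AbelianSchemeOver

end Literature.AlgebraicGeometry.AbelianSchemes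

end
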